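import Summits.ABC.ABC.Theorems.PadicPrimesKummerThirdY07Odd
import HarnessLib

/-!
# Cell abc-stewartyu, route `PadicPrimesKummerThird` (rung A1.M3): the crux `Y07Odd` with an EXPLICIT constant

`Summits/ABC/StewartYu/Y07OddExplicit.lean` — cell `abc-stewartyu` (HOME `run/shared/lean/pub/abc-stewartyu/`), seat p5 (g5).
Theorems only; a by-product of the closed crux stmt-ABC-19658 (`Summit.ABC.ABC.Theorems.Y07Odd_proof`, p2-g4).

The crux text `Y07Odd` is existential in its constant (`∃ c₆, …`), and the landed chain packages its constant
existentially twice (`GenThreeInductionOdd.engineOdd_of_core`, `YuOhSeven.y07Odd_of_genThreeEngineOdd`), so no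
closed-form `c₆` can be read off the accepted closer.  This file runs the same chain with the constant kept in the
open:

* `coreOdd_two_pow_100` — the odd-`p` Gen-3 engine's internal statement `CoreOdd C p r` holds for EVERY odd prime
  `p` and EVERY rank `r` with `C m = (2^100)^m` (Matveev's induction `core_of_dichotomy` over the landed per-rank
  dichotomy: ranks `0, 1` elementary (`GenThreeBaseOdd`), ranks `≥ 2` = the analytic frame `frameOdd_of_recordR` on the
  record supply `Y07Odd_recordSupplyOddR` of the closer, at the zero estimate `Nesterenko2003_prop51_holds`);
* `y07Odd_explicit` — **for every odd prime `p`, every finite non-empty set `S` of primes with `p ∉ S`, exponents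
  `|e_q| ≤ B` (`B ≥ 3`) with `∏ q^{e_q} ≠ 1`:
  `ord_p(∏_{q∈S} q^{e_q} − 1)·log p < (2^103)^{#S} · (p/log p) · (log p + log B + log log A) · ∏_{q∈S} log q`,
  `A = max(4, max S)`** — i.e. the crux text with `c₆ := 2^103` (`αⱼ = qⱼ`, weights `Vⱼ = log qⱼ / log 2 ≥ 1`,
  `Vmax = log A / log 2`, `W = log B`; the slack `2·(2^100/log 2)^m < (2^103)^m`);
* `y07Odd_of_explicit` — the crux text itself, re-derived from the explicit form (second proof of `Y07Odd`).

Numbers, for the closing memo of rung A1.M3: the kernel's constant for Yu's 2007 bound over `ℚ` at an odd prime and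
rational primes is `c₆ = 2^103` per logarithm (print: `(16e)^{2(n+1)} n^{5/2} log(2n) log 2`, Yu 2007 p. 190; the
kernel constant is NOT claimed to be of print quality).

References: K. Yu, Forum Math. 19 (2007), Main Theorem (`K = ℚ`); Yu. V. Nesterenko, LNM 1819 (2003) §§3–5.
-/

noncomputable section

open Finset Real Height
open Literature.NumberTheory.Transcendental

namespace Summit.ABC.StewartYu

namespace YuOhSeven

open Summit.ABC.ABC.Theorems

/-- **The odd-`p` engine's internal statement with the explicit constant `C m = (2^100)^m`**, every odd prime `p`,
every rank `r`: Matveev's induction on the rank over the landed per-rank dichotomy (ranks `0, 1`: `GenThreeBaseOdd`;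
ranks `≥ 2`: the analytic frame on the closer's record supply `Y07Odd_recordSupplyOddR`, at the zero estimate
`Nesterenko2003_prop51_holds`). [cite: Yu2007, Main Thm (K = ℚ); shape only] -/
theorem coreOdd_two_pow_100 (p : ℕ) [Fact p.Prime] (hp2 : p ≠ 2) (r : ℕ) :
    GenThreeInductionOdd.CoreOdd (fun m => ((2 : ℝ) ^ 100) ^ m) p r := by
  refine GenThreeInductionOdd.core_of_dichotomy (fun n => ?_) r
  rcases Nat.lt_or_ge n 2 with hn | hn
  · interval_cases n
    · exact GenThreeBaseOdd.dichotomyOdd_zero _ p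
    · exact GenThreeBaseOdd.dichotomyOdd_one hp2 (by norm_num)
  · exact GenThreeFrameSpecOdd.dichotomyOdd_of_frame Nesterenko2003_prop51_holds (fun r => by positivity)
      (G3Setup.frameOdd_of_recordR (by omega) hp2 (Y07Odd_recordSupplyOddR p n hn hp2))

/-- **`Y07Odd` with the explicit constant `c₆ = 2^103`**: for every odd prime `p`, every finite non-empty set `S`
of primes with `p ∉ S`, exponents `|e_q| ≤ B` (`B ≥ 3`) and `∏ q^{e_q} ≠ 1`,
`ord_p(∏_{q∈S} q^{e_q} − 1)·log p < (2^103)^{#S}·(p/log p)·(log p + log B + log log max(4, max S))·∏_{q∈S} log q`.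
(`αⱼ = qⱼ`: `p`-adic units, multiplicatively independent and signed-`2`-Kummer by unique factorisation;
`Vⱼ = log qⱼ/log 2`, `Vmax = log A/log 2`, `W = log B` in `coreOdd_two_pow_100`.)
[cite: Yu2007, Main Thm (K = ℚ); shape only] -/
theorem y07Odd_explicit (p : ℕ) (hp : p.Prime) (hp2 : p ≠ 2) (S : Finset ℕ) (hS : ∀ q ∈ S, q.Prime)
    (hpS : p ∉ S) (hSne : S.Nonempty) (e : ℕ → ℤ) (B : ℝ) (hB : 3 ≤ B) (heB : ∀ q ∈ S, (|e q| : ℝ) ≤ B)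
    (hne1 : ∏ q ∈ S, (q : ℚ) ^ e q ≠ 1) :
    (padicValRat p (∏ q ∈ S, (q : ℚ) ^ e q - 1) : ℝ) * Real.log p <
      ((2 : ℝ) ^ 103) ^ S.card * ((p : ℝ) / Real.log p) *
        (Real.log p + Real.log B + Real.log (Real.log ((max 4 (S.sup id) : ℕ) : ℝ))) *
        ∏ q ∈ S, Real.log (q : ℝ) := by
  classical
  haveI := Fact.mk hp
  -- enumeration of `S`
  set m : ℕ := S.card with hm
  have hm1 : 1 ≤ m := Finset.card_pos.mpr hSne
  set φ : Fin m ≃ S := S.equivFin.symm with hφ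
  set q : Fin m → ℕ := fun i => (φ i : ℕ) with hqdef
  have hqS : ∀ i, q i ∈ S := fun i => (φ i).2
  have hqP : ∀ i, (q i).Prime := fun i => hS _ (hqS i)
  have hinj : Function.Injective q := fun i j hij => φ.injective (Subtype.ext hij)
  have hqp : ∀ i, q i ≠ p := fun i h => hpS (h ▸ hqS i)
  have hreidx : ∀ {M : Type} [CommMonoid M] (f : ℕ → M), ∏ i, f (q i) = ∏ x ∈ S, f x := by
    intro M _ f
    rw [← Finset.prod_coe_sort S f]
    exact Fintype.prod_equiv φ (fun i => f (q i)) (fun x => f x) (fun i => rfl)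
  -- the data fed to the engine
  set L : ℝ := Real.log p with hL
  set M4 : ℝ := ((max 4 (S.sup id) : ℕ) : ℝ) with hM4
  set X : ℝ := Real.log M4 with hX
  set l2 : ℝ := Real.log 2 with hl2def
  set α : Fin m → ℚ := fun j => (q j : ℚ) with hα
  set b : Fin m → ℤ := fun j => e (q j) with hb
  set V : Fin m → ℝ := fun j => Real.log (q j : ℝ) / l2 with hV
  set Vmax : ℝ := X / l2 with hVmax
  set W : ℝ := Real.log B with hW
  -- numerics
  have hp3 : 3 ≤ p := by have := hp.two_le; omega
  have hp3R : (3 : ℝ) ≤ p := by exact_mod_cast hp3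
  have hpR0 : (0 : ℝ) < p := by linarith
  have hlog3 : (1 : ℝ) < Real.log 3 := by
    rw [Real.lt_log_iff_exp_lt (by norm_num)]
    exact Real.exp_one_lt_d9.trans (by norm_num)
  have hL1 : 1 < L := hlog3.trans_le (Real.log_le_log (by norm_num) hp3R)
  have hL0 : 0 < L := by linarith
  have hX1 : (1.38 : ℝ) ≤ X := (loglog_max_four_bounds (S.sup id)).1
  have hℓ : (0.27 : ℝ) ≤ Real.log X := (loglog_max_four_bounds (S.sup id)).2
  have hX0 : 0 < X := by linarith
  have hl2 : (1 : ℝ) / 2 < l2 := by have := Real.log_two_gt_d9; rw [hl2def]; linarith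
  have hl2' : l2 < 1 := by have := Real.log_two_lt_d9; rw [hl2def]; linarith
  have hl2pos : 0 < l2 := by linarith
  have hq2R : ∀ j, (2 : ℝ) ≤ q j := fun j => by exact_mod_cast (hqP j).two_le
  have hlogq : ∀ j, l2 ≤ Real.log (q j : ℝ) := fun j => Real.log_le_log (by norm_num) (hq2R j)
  have hlogq0 : ∀ j, 0 ≤ Real.log (q j : ℝ) := fun j => hl2pos.le.trans (hlogq j)
  -- the engine's hypotheses
  have h1 : ∀ j, α j ≠ 0 ∧ padicValRat p (α j) = 0 := fun j =>
    ⟨by simp only [hα]; exact_mod_cast (hqP j).ne_zero,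
      Literature.Barriers.ABC.StewartTijdemanGeneric.padicValRat_natCast_prime_of_ne hp (hqP j) (hqp j)⟩
  have h2 : ∀ μ : Fin m → ℤ, ∏ j, α j ^ μ j = 1 → μ = 0 := fun μ hμ =>
    Literature.Barriers.ABC.StewartTijdemanGeneric.prime_family_zpow_eq_one hqP hinj hμ
  have h3 : ∀ κ : Fin m → ℤ, (∃ γ : ℚ, ∏ j, α j ^ κ j = γ ^ 2 ∨ ∏ j, α j ^ κ j = -γ ^ 2) →
      ∀ j, (2 : ℤ) ∣ κ j :=
    GenThreeInductionOdd.kummerPM_of_not_isSquare α (fun j => (h1 j).1)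
      (fun T hT => not_isSquare_prod_distinct_primes q hqP hinj T hT)
  have h4 : ∀ j, logHeight₁ (α j) ≤ V j := by
    intro j
    haveI : NeZero (q j) := ⟨(hqP j).ne_zero⟩
    have hh : logHeight₁ (α j) = Real.log (q j) := by
      simp only [hα]; exact Rat.logHeight₁_natCast (q j)
    rw [hh, hV]
    dsimp only
    rw [le_div_iff₀ hl2pos]
    have := hlogq0 j
    nlinarith
  have h5 : ∀ j, 1 ≤ V j := fun j => by
    rw [hV]; dsimp only; rw [le_div_iff₀ hl2pos, one_mul]; exact hlogq j
  have h6 : ∀ j, V j ≤ Vmax := by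
    intro j
    have hle : (q j : ℝ) ≤ M4 := by
      rw [hM4]
      have : q j ≤ max 4 (S.sup id) := le_trans (Finset.le_sup (f := id) (hqS j)) (le_max_right _ _)
      exact_mod_cast this
    have hlogle : Real.log (q j : ℝ) ≤ X := Real.log_le_log (by linarith [hq2R j]) hle
    rw [hV, hVmax]
    exact div_le_div_of_nonneg_right hlogle hl2pos.le
  have hprodQ : ∏ j, α j ^ b j = ∏ x ∈ S, (x : ℚ) ^ e x := hreidx (fun x => (x : ℚ) ^ e x)
  have h7 : b ≠ 0 := by
    intro h0
    apply hne1
    rw [← hprodQ]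
    exact Finset.prod_eq_one fun j _ => by rw [show b j = 0 from congrFun h0 j, zpow_zero]
  have hB1 : 1 ≤ W := hlog3.le.trans (Real.log_le_log (by norm_num) hB)
  have h8 : ∀ j, Real.log (max 3 (|b j| : ℝ)) ≤ W := by
    intro j
    have hle : max 3 (|b j| : ℝ) ≤ B := max_le hB (by simp only [hb]; exact heB _ (hqS j))
    exact Real.log_le_log (lt_of_lt_of_le (by norm_num) (le_max_left _ _)) hle
  -- the engine
  have key := coreOdd_two_pow_100 p hp2 m α b V Vmax W h1 h2 h3 h4 h5 h6 h7 h8 hB1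
  rw [hprodQ] at key
  -- `∏ Vⱼ = (∏_{q ∈ S} log q) / (log 2)^m`
  set PL : ℝ := ∏ x ∈ S, Real.log (x : ℝ) with hPL
  have hPV : ∏ j, V j = PL / l2 ^ m := by
    rw [hPL, ← hreidx (fun x => Real.log (x : ℝ)), hV]
    simp only []
    rw [Finset.prod_div_distrib, Finset.prod_const, Finset.card_univ, Fintype.card_fin]
  have hPL0 : 0 < PL := by
    rw [hPL, ← hreidx (fun x => Real.log (x : ℝ))]
    exact Finset.prod_pos fun j _ => lt_of_lt_of_le hl2pos (hlogq j)
  -- the garbage: `W + L + log(2X/log 2) ≤ 2 (L + W + log X)`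
  set Q : ℝ := L + W + Real.log X with hQ
  have hQ2 : 2 ≤ Q := by rw [hQ]; linarith
  have hQ0 : 0 < Q := by linarith
  have hll2 : -Real.log l2 ≤ 1 := by
    have h1' : Real.log (1 / 2) < Real.log l2 := Real.log_lt_log (by norm_num) hl2
    rw [Real.log_div one_ne_zero two_ne_zero, Real.log_one, zero_sub, ← hl2def] at h1'
    linarith
  have hlog2X : Real.log (2 * Vmax) = l2 + Real.log X - Real.log l2 := by
    rw [hVmax, mul_div_assoc', Real.log_div (by positivity) hl2pos.ne', Real.log_mul (by norm_num) hX0.ne', hl2def]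
  have hgarb : W + Real.log p + Real.log (2 * Vmax) ≤ 2 * Q := by
    rw [hlog2X, ← hL, hQ]; linarith
  -- assemble: `v·L ≤ C (p/L) (PL/l2^m) (…) ≤ 2·(2^100/l2)^m (p/L) Q PL < (2^103)^m (p/L) Q PL`
  set v : ℝ := (padicValRat p (∏ x ∈ S, (x : ℚ) ^ e x - 1) : ℝ) with hv
  have hpL : 0 < (p : ℝ) / L := div_pos hpR0 hL0
  have hC0 : (0 : ℝ) ≤ ((2 : ℝ) ^ 100) ^ m := by positivity
  have hl2m : 0 < l2 ^ m := pow_pos hl2pos m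
  have hstep1 : v * L ≤ ((2 : ℝ) ^ 100) ^ m * ((p : ℝ) / L) * (PL / l2 ^ m) * (2 * Q) := by
    have h0 : 0 ≤ ((2 : ℝ) ^ 100) ^ m * ((p : ℝ) / L) * (PL / l2 ^ m) :=
      mul_nonneg (mul_nonneg hC0 hpL.le) (div_nonneg hPL0.le hl2m.le)
    calc v * L ≤ ((2 : ℝ) ^ 100) ^ m * ((p : ℝ) / L) * (∏ j, V j) * (W + Real.log p + Real.log (2 * Vmax)) := key
      _ = ((2 : ℝ) ^ 100) ^ m * ((p : ℝ) / L) * (PL / l2 ^ m) * (W + Real.log p + Real.log (2 * Vmax)) := by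
          rw [hPV]
      _ ≤ ((2 : ℝ) ^ 100) ^ m * ((p : ℝ) / L) * (PL / l2 ^ m) * (2 * Q) := mul_le_mul_of_nonneg_left hgarb h0
  have hstep2 : ((2 : ℝ) ^ 100) ^ m * ((p : ℝ) / L) * (PL / l2 ^ m) * (2 * Q) =
      2 * ((2 : ℝ) ^ 100 / l2) ^ m * (((p : ℝ) / L) * Q * PL) := by
    rw [div_pow]
    field_simp
  -- `2·(2^100/l2)^m < (2^103)^m`: `2^100/l2 < 2^102` (`l2 > 1/2`) and `2·(2^102)^m ≤ 2^m·(2^102)^m`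
  have hbase : (2 : ℝ) ^ 100 / l2 < (2 : ℝ) ^ 102 := by
    rw [div_lt_iff₀ hl2pos]
    nlinarith
  have hbase0 : (0 : ℝ) ≤ (2 : ℝ) ^ 100 / l2 := by positivity
  have henv : 2 * ((2 : ℝ) ^ 100 / l2) ^ m < ((2 : ℝ) ^ 103) ^ m := by
    have hpow : ((2 : ℝ) ^ 100 / l2) ^ m < ((2 : ℝ) ^ 102) ^ m :=
      pow_lt_pow_left₀ hbase hbase0 (by omega)
    have h2m : (2 : ℝ) ≤ 2 ^ m := by
      calc (2 : ℝ) = 2 ^ 1 := by norm_num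
        _ ≤ 2 ^ m := pow_le_pow_right₀ (by norm_num) hm1
    have hsplit : ((2 : ℝ) ^ 103) ^ m = 2 ^ m * ((2 : ℝ) ^ 102) ^ m := by
      rw [← mul_pow]; norm_num
    rw [hsplit]
    have h102 : (0 : ℝ) < ((2 : ℝ) ^ 102) ^ m := by positivity
    have h2' : 2 * ((2 : ℝ) ^ 102) ^ m ≤ 2 ^ m * ((2 : ℝ) ^ 102) ^ m := mul_le_mul_of_nonneg_right h2m h102.le
    exact lt_of_lt_of_le (mul_lt_mul_of_pos_left hpow two_pos) h2'
  have hpos : 0 < ((p : ℝ) / L) * Q * PL := mul_pos (mul_pos hpL hQ0) hPL0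
  calc v * L ≤ ((2 : ℝ) ^ 100) ^ m * ((p : ℝ) / L) * (PL / l2 ^ m) * (2 * Q) := hstep1
    _ = 2 * ((2 : ℝ) ^ 100 / l2) ^ m * (((p : ℝ) / L) * Q * PL) := hstep2
    _ < ((2 : ℝ) ^ 103) ^ m * (((p : ℝ) / L) * Q * PL) := mul_lt_mul_of_pos_right henv hpos
    _ = ((2 : ℝ) ^ 103) ^ m * ((p : ℝ) / L) * (L + W + Real.log X) * PL := by rw [hQ]; ring

/-- The crux text `Y07Odd` re-derived from the explicit form (`c₆ := 2^103`): a second, constant-bearing proof of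
the closed crux stmt-ABC-19658. [cite: Yu2007, Main Thm (K = ℚ)] -/
theorem y07Odd_of_explicit : Summit.ABC.ABC.Theses.PadicPrimesKummerThird.Y07Odd :=
  ⟨(2 : ℝ) ^ 103, fun p hp hp2 S hS hpS hSne e B hB heB hne1 =>
    y07Odd_explicit p hp hp2 S hS hpS hSne e B hB heB hne1⟩

end YuOhSeven

end Summit.ABC.StewartYu

end
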